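import Mathlib.Topology.Sequences
import Mathlib.Geometry.Manifold.IsManifold.ExtChartAt
import Literature.Geometry.Lorentzian.GlobalHyperbolicityStrongCausality
import Literature.Geometry.Lorentzian.CausalFutureProofs
import Literature.Geometry.Lorentzian.CausalityOpennessProofs
import Literature.Geometry.Lorentzian.CausalityClosure
import Literature.Geometry.Lorentzian.CausalityConditionsProofs
import HarnessLib

/-!
# Globally hyperbolic spacetimes are strongly causal: proof (Bernal–Sánchez 2007, Thm. 3.2)

This file discharges the named fact
`Literature.Geometry.Lorentzian.LorentzianMetric.bernalSanchez_isStronglyCausal_of_isGloballyHyperbolic`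
of `Literature.Geometry.Lorentzian.GlobalHyperbolicityStrongCausality`:
`theorem bernalSanchez_isStronglyCausal_of_isGloballyHyperbolic_holds`. On a connected, Hausdorff,
second countable, finite-dimensional manifold without boundary with a `C²` time-oriented Lorentzian
metric, *causal + compact causal diamonds* (`IsGloballyHyperbolic`) implies *strongly causal*
(`IsStronglyCausal`) — implication (A) ∧ (B1) ⇒ (B2) of Bernal–Sánchez, Class. Quantum Grav. 24
(2007) 745–749, Thm. 3.2 (arXiv gr-qc/0611138, p. 3).

## The printed proof and the road taken here

Bernal–Sánchez (loc. cit., p. 4): "By Lemma 3.1 (A) plus (B1) imply conditions (a) plus (b1) in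
Proposition 2.1 i.e., causal simplicity. This is a more restrictive level of the causal ladder
than strong causality (a standard reference is [1, p. 73] …), and thus, the result follows", the
descent of the ladder running (Remark 3.3) through causal continuity, the volume time functions
`t±(p) = m(J±(p))` and stable causality. Lemma 3.1 — (A) ⇒ every `J⁺(p)`, `J⁻(p)` is closed — is
in the tree (`LorentzianMetric.isClosed_causalFuture_singleton_of_isCompact`,
`….isClosed_causalPast_singleton_of_isCompact`, `Literature.Geometry.Lorentzian.CausalityProofs`).
For the step *causally simple ⇒ strongly causal* we do **not** formalize the ladder (time
functions); instead we use the standard direct argument through the closedness of the causal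
relation, as in Minguzzi–Sánchez 2008, Lemma 3.67 (2) ("Let `J⁺(p)` and `J⁻(p)` be closed for
every `p ∈ M`, then … `J⁺`, regarded as a subset of `M × M`, is closed") and the proof of their
Thm. 3.27 (failure of strong causality at `p` produces causal curves with endpoints converging to
`p` which leave a fixed neighbourhood, whose exit points accumulate at some `q` with `q ≤ p`):

1. `LorentzianMetric.mem_causalFuture_singleton_of_tendsto` — **the causal relation is closed**
   when all `J±(pt)` are closed (here: when all causal diamonds are compact): if `xₖ → x`,
   `yₖ → y` and `yₖ ∈ J⁺(xₖ)` then `y ∈ J⁺(x)`. Proof: for `x' ≪ x` on a timelike curve into `x`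
   (`exists_isFutureTimelikeCurveOn_Ioo_of_isInteriorPoint`), `I⁺(x')` is an open neighbourhood of
   `x` (`isOpen_chronologicalFuture_of_boundaryless`), so eventually `yₖ ∈ J⁺(J⁺(x')) = J⁺(x')`
   (`causalFuture_causalFuture_eq`), a closed set, whence `y ∈ J⁺(x')`, i.e. `x' ∈ J⁻(y)`; letting
   `x' → x` along the curve and using closedness of `J⁻(y)` gives `x ∈ J⁻(y)`.
2. `exists_mem_diff_interior_of_continuousOn` — a connected arc from `interior B` to `Bᶜ` meets
   `B \ interior B` (point-set topology).
3. The discharge: if strong causality failed at `p` inside `U`, pick a compact neighbourhood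
   `B ⊆ U` of `p` (finite-dimensional manifolds are locally compact) and a countable neighbourhood
   basis `Vₖ ⊆ interior B`; the offending causal segments `γₖ` with endpoints in `Vₖ` leave
   `U ⊇ B`, so pass through points `yₖ ∈ B \ interior B`, a compact set missing `p`; a subsequence
   converges to `y ≠ p`, and step 1 applied to (initial points, `yₖ`) and to (`yₖ`, final points)
   gives `y ∈ J⁺(p)` and `p ∈ J⁺(y)`. Concatenating the two causal curves with rounded corner
   (`exists_isFutureCausalCurveOn_trans`, `Literature.Geometry.Lorentzian.CausalFutureProofs`)
   yields a closed causal curve through `p`, contradicting the causality condition (B1).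

Of the standing hypotheses of the fact only Hausdorff, no boundary, finite dimension, second
countability (for subsequences) and `2 ≤ n` (corner rounding needs `C¹`) are used; connectedness
is not.

## References

* A. N. Bernal, M. Sánchez, *Globally hyperbolic spacetimes can be defined as "causal" instead of
  "strongly causal"*, Class. Quantum Grav. 24 (2007) 745–749, Lemma 3.1, Thm. 3.2, Remark 3.3.
  Key `BernalSanchez2007CQG`.
* E. Minguzzi, M. Sánchez, *The causal hierarchy of spacetimes*, in: Recent developments in
  pseudo-Riemannian geometry, ESI Lect. Math. Phys., EMS 2008, 299–358 (arXiv gr-qc/0609119):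
  Lemma 3.67, Prop. 3.68, Thm. 3.27, Prop. 3.71 (numbering of the arXiv version).
  Key `MinguzziSanchezcaja2008`.
* B. O'Neill, *Semi-Riemannian geometry with applications to relativity*, Academic Press 1983,
  Ch. 14, p. 402 (causality relations), Def. 14.11 (strong causality), Lemma 14.22.
  Key `ONeillSemiRiemannian1983`.
-/

noncomputable section

open Bundle Set Filter Function
open scoped Manifold ContDiff Topology

namespace Literature.Geometry.Lorentzian

variable {E : Type*} [NormedAddCommGroup E] [NormedSpace ℝ E] {H : Type*} [TopologicalSpace H]
  {I : ModelWithCorners ℝ E H} {n : ℕ∞ω} {M : Type*} [TopologicalSpace M] [ChartedSpace H M]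
  [IsManifold I ∞ M]

/-! ### A point-set lemma: a connected arc leaving a set passes through its rim -/

omit [ChartedSpace H M] [IsManifold I ∞ M] in
/-- If a curve `γ`, continuous on `[a, b]`, starts in the interior of a closed set `B` and has a
point outside `B`, then it passes through `B \ interior B`: otherwise the connected image
`γ([a, b])` would be covered by the disjoint open sets `interior B` and `Bᶜ`, meeting both.
[folklore] -/
lemma exists_mem_diff_interior_of_continuousOn {γ : ℝ → M} {a b : ℝ} (hab : a ≤ b)
    (hγc : ContinuousOn γ (Icc a b)) {B : Set M} (hB : IsClosed B) (ha : γ a ∈ interior B)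
    {t : ℝ} (ht : t ∈ Icc a b) (hγt : γ t ∉ B) :
    ∃ s ∈ Icc a b, γ s ∈ B \ interior B := by
  by_contra! h
  have hconn : IsPreconnected (γ '' Icc a b) := isPreconnected_Icc.image γ hγc
  have hcover : γ '' Icc a b ⊆ interior B ∪ Bᶜ := by
    rintro _ ⟨s, hs, rfl⟩
    by_cases hsB : γ s ∈ B
    · exact Or.inl (by_contra fun hni ↦ h s hs ⟨hsB, hni⟩)
    · exact Or.inr hsB
  have h1 : (γ '' Icc a b ∩ interior B).Nonempty :=
    ⟨γ a, mem_image_of_mem γ (left_mem_Icc.mpr hab), ha⟩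
  have h2 : (γ '' Icc a b ∩ Bᶜ).Nonempty := ⟨γ t, mem_image_of_mem γ ht, hγt⟩
  obtain ⟨z, -, hzi, hzc⟩ := hconn _ _ isOpen_interior hB.isOpen_compl hcover h1 h2
  exact hzc (interior_subset hzi)

namespace LorentzianMetric

variable {g : LorentzianMetric I n M} {τ : TimeOrientation g}

/-! ### Points of a causal segment are causally between its endpoints -/

/-- Every point `γ t`, `t ∈ [a, b]`, of a future causal curve on `[a, b]` lies in `J⁺(γ a)`
(restrict the curve to `[a, t]`; for `t = a` use `γ a ∈ J⁺(γ a)`). O'Neill 1983, Ch. 14, p. 402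
(`p ≤ q`: "either `p = q` or there is a future-pointing causal curve from `p` to `q`").
[cite: ONeillSemiRiemannian1983, Ch. 14, p. 402] -/
lemma IsFutureCausalCurveOn.apply_mem_causalFuture_apply_left {γ : ℝ → M} {a b t : ℝ}
    (hγ : g.IsFutureCausalCurveOn τ γ (Icc a b)) (ht : t ∈ Icc a b) :
    γ t ∈ g.causalFuture τ {γ a} := by
  rcases eq_or_lt_of_le ht.1 with h | h
  · exact Or.inl (by rw [h, mem_singleton_iff])
  · exact Or.inr ⟨γ a, rfl, γ, a, t, h, hγ.mono (Icc_subset_Icc_right ht.2), rfl, rfl⟩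

/-- The final point `γ b` of a future causal curve on `[a, b]` lies in `J⁺(γ t)` for every
`t ∈ [a, b]` (restrict the curve to `[t, b]`; for `t = b` use `γ b ∈ J⁺(γ b)`). O'Neill 1983,
Ch. 14, p. 402. [cite: ONeillSemiRiemannian1983, Ch. 14, p. 402] -/
lemma IsFutureCausalCurveOn.apply_right_mem_causalFuture_apply {γ : ℝ → M} {a b t : ℝ}
    (hγ : g.IsFutureCausalCurveOn τ γ (Icc a b)) (ht : t ∈ Icc a b) :
    γ b ∈ g.causalFuture τ {γ t} := by
  rcases eq_or_lt_of_le ht.2 with h | h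
  · exact Or.inl (by rw [h, mem_singleton_iff])
  · exact Or.inr ⟨γ t, rfl, γ, t, b, h, hγ.mono (Icc_subset_Icc_left ht.1), rfl, rfl⟩

/-! ### The causal relation is closed when causal diamonds are compact -/

/-- **Closedness of the causal relation** (Minguzzi–Sánchez 2008, Lemma 3.67 (2): "Let `J⁺(p)`
and `J⁻(p)` be closed for every `p ∈ M`, then … `J⁺`, regarded as a subset of `M × M`, is
closed"), in sequential form and under compactness of the causal diamonds, which gives the
closedness of all `J±(pt)` (Bernal–Sánchez 2007, Lemma 3.1; in the tree
`isClosed_causalFuture_singleton_of_isCompact`): on a Hausdorff manifold without boundary with a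
`C²` time-oriented metric, if `xₖ → x`, `yₖ → y` and `yₖ ∈ J⁺(xₖ)` for all `k`, then
`y ∈ J⁺(x)`. Proof: for a point `x' = γ s ≪ x` on a future timelike curve `γ` with `γ 0 = x`,
the open set `I⁺(x') ∋ x` eventually contains `xₖ`, so `yₖ ∈ J⁺(J⁺(x')) = J⁺(x')` eventually and
`y ∈ J⁺(x')` by closedness, i.e. `γ s ∈ J⁻(y)`; as `s ↑ 0`, `γ s → x` and `J⁻(y)` is closed.
The time duality `q ∈ J⁺(z) ↔ z ∈ J⁻(q)` between points (read a causal curve backwards,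
`IsFutureCausalCurveOn.reverseParam`; O'Neill 1983, Ch. 14, p. 402) is proved inline.
[cite: MinguzziSanchezcaja2008, Lemma 3.67 (2) and Prop. 3.68 (arXiv gr-qc/0609119 numbering)] -/
theorem mem_causalFuture_singleton_of_tendsto [T2Space M] [BoundarylessManifold I M]
    (hn : 2 ≤ n) (hJ : ∀ p q : M, IsCompact (g.causalFuture τ {p} ∩ g.causalPast τ {q}))
    {x y : ℕ → M} {x₀ y₀ : M} (hx : Tendsto x atTop (𝓝 x₀)) (hy : Tendsto y atTop (𝓝 y₀))
    (hxy : ∀ k, y k ∈ g.causalFuture τ {x k}) : y₀ ∈ g.causalFuture τ {x₀} := by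
  -- time duality for points: `q ∈ J⁺(z) → z ∈ J⁻(q)` and `z ∈ J⁻(q) → q ∈ J⁺(z)`
  have toPast : ∀ {z q : M}, q ∈ g.causalFuture τ {z} → z ∈ g.causalPast τ {q} := by
    intro z q h
    rcases h with h | ⟨z', hz', c, a, b, hab, hc, hca, hcb⟩
    · rw [mem_singleton_iff] at h
      subst h
      exact Or.inl rfl
    · rw [mem_singleton_iff] at hz'
      subst hz'
      refine Or.inr ⟨q, rfl, fun r ↦ c (a + b - r), a, b, hab, hc.reverseParam, ?_, ?_⟩
      · simp [hcb]
      · simp [hca]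
  have toFuture : ∀ {z q : M}, z ∈ g.causalPast τ {q} → q ∈ g.causalFuture τ {z} := by
    intro z q h
    rcases h with h | ⟨q', hq', c, a, b, hab, hc, hca, hcb⟩
    · rw [mem_singleton_iff] at h
      subst h
      exact Or.inl rfl
    · rw [mem_singleton_iff] at hq'
      subst hq'
      refine Or.inr ⟨z, rfl, fun r ↦ c (a + b - r), a, b, hab,
        isFutureCausalCurveOn_reverse_reverse_iff.mp hc.reverseParam, ?_, ?_⟩
      · simp [hcb]
      · simp [hca]
  -- a future timelike curve `γ` with `γ 0 = x₀`
  obtain ⟨γ, ε, hε, hγ0, hγ⟩ := g.exists_isFutureTimelikeCurveOn_Ioo_of_isInteriorPoint τ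
    (BoundarylessManifold.isInteriorPoint (I := I) (x := x₀))
  -- for `s ∈ (-ε, 0)`: `y₀ ∈ J⁺(γ s)`
  have hstep : ∀ s ∈ Ioo (-ε) 0, y₀ ∈ g.causalFuture τ {γ s} := by
    intro s hs
    have hxI : x₀ ∈ g.chronologicalFuture τ {γ s} :=
      ⟨γ s, rfl, γ, s, 0, hs.2, hγ.mono (Icc_subset_Ioo hs.1 hε), rfl, hγ0⟩
    have h1 : ∀ᶠ k in atTop, x k ∈ g.chronologicalFuture τ {γ s} :=
      hx.eventually_mem ((isOpen_chronologicalFuture_of_boundaryless g τ {γ s}).mem_nhds hxI)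
    have h2 : ∀ᶠ k in atTop, y k ∈ g.causalFuture τ {γ s} := by
      filter_upwards [h1] with k hk
      have h3 : y k ∈ g.causalFuture τ (g.causalFuture τ {γ s}) :=
        causalFuture_mono (singleton_subset_iff.mpr
          (chronologicalFuture_subset_causalFuture g τ {γ s} hk)) (hxy k)
      rwa [causalFuture_causalFuture_eq hn] at h3
    exact (isClosed_causalFuture_singleton_of_isCompact hJ (γ s)).mem_of_tendsto hy h2
  -- hence `γ s ∈ J⁻(y₀)` for these `s`; let `s ↑ 0`
  have hcont : ContinuousAt γ 0 := (hγ 0 (by simp [hε])).1.continuousAt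
  have htend : Tendsto γ (𝓝[<] 0) (𝓝 x₀) := by
    rw [← hγ0]
    exact hcont.tendsto.mono_left nhdsWithin_le_nhds
  have hev : ∀ᶠ s in 𝓝[<] (0 : ℝ), γ s ∈ g.causalPast τ {y₀} := by
    filter_upwards [Ioo_mem_nhdsLT (neg_lt_zero.mpr hε)] with s hs
    exact toPast (hstep s hs)
  exact toFuture ((isClosed_causalPast_singleton_of_isCompact hJ y₀).mem_of_tendsto htend hev)

/-! ### The discharge -/

variable (g τ) in
/-- **Discharge of `bernalSanchez_isStronglyCausal_of_isGloballyHyperbolic` (Bernal–Sánchez 2007,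
Thm. 3.2, (A) ∧ (B1) ⇒ (B2)): a globally hyperbolic (= causal with compact causal diamonds)
time-oriented `C²` Lorentzian manifold which is connected, Hausdorff, second countable,
finite-dimensional and without boundary is strongly causal.** "Assume that `(M, g)` satisfies:
(A) `J⁺(p) ∩ J⁻(q)` is compact for all `p, q ∈ M`. Then the following two conditions are
equivalent: (B1) `(M, g)` is causal … (B2) `(M, g)` is strongly causal" (loc. cit., p. 3).
Proof (direct, see the module docstring; the printed proof descends the causal ladder instead):
if strong causality failed at `p` inside a neighbourhood `U`, take a compact neighbourhood
`B ⊆ U` of `p` and a countable neighbourhood basis `Vₖ ⊆ interior B` of `p`; the offending causal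
segments `γₖ : [aₖ, bₖ] → M` with endpoints in `Vₖ` leave `B`, hence pass through
`yₖ ∈ B \ interior B` (`exists_mem_diff_interior_of_continuousOn`), a compact set not containing
`p`; along a subsequence `yₖ → y ≠ p`, while `γₖ aₖ → p`, `γₖ bₖ → p`, and
`yₖ ∈ J⁺(γₖ aₖ)`, `γₖ bₖ ∈ J⁺(yₖ)`; by closedness of the causal relation
(`mem_causalFuture_singleton_of_tendsto`, from Lemma 3.1 = compact diamonds ⇒ closed `J±(pt)`)
`y ∈ J⁺(p)` and `p ∈ J⁺(y)`, so the concatenation with rounded corner of the two causal curves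
(`exists_isFutureCausalCurveOn_trans`) is a closed causal curve through `p`, contradicting (B1).
[cite: BernalSanchez2007CQG, Thm. 3.2 (p. 747; arXiv gr-qc/0611138 p. 3)] -/
theorem bernalSanchez_isStronglyCausal_of_isGloballyHyperbolic_holds :
    bernalSanchez_isStronglyCausal_of_isGloballyHyperbolic g τ := by
  intro _ _ _ _ _ hn hG p U hU
  haveI : LocallyCompactSpace M := Manifold.locallyCompact_of_finiteDimensional (M := M) I
  have hn1 : (1 : ℕ∞ω) ≤ n := le_trans (by norm_num) hn
  -- a compact neighbourhood `B ⊆ U` of `p` and its rim `B \ interior B`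
  obtain ⟨B, hBn, hBU, hBc⟩ := local_compact_nhds hU
  have hpB : p ∈ interior B := mem_interior_iff_mem_nhds.mpr hBn
  have hBcl : IsClosed B := hBc.isClosed
  have hK : IsCompact (B \ interior B) := hBc.diff isOpen_interior
  -- a countable neighbourhood basis of `p`
  obtain ⟨u, hu⟩ := (𝓝 p).exists_antitone_basis
  by_contra hbad
  push Not at hbad
  -- the offending causal segments, with endpoints in `u k ∩ interior B`, leaving `U`
  have hcurve : ∀ k : ℕ, ∃ (γ : ℝ → M) (a b : ℝ), a < b ∧
      g.IsFutureCausalCurveOn τ γ (Icc a b) ∧ γ a ∈ u k ∩ interior B ∧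
      γ b ∈ u k ∩ interior B ∧ ∃ t ∈ Icc a b, γ t ∉ U := fun k ↦
    hbad _ (inter_mem (hu.mem k) (isOpen_interior.mem_nhds hpB))
      (inter_subset_right.trans (interior_subset.trans hBU))
  choose γ a b hab hγ hγa hγb hout using hcurve
  -- each of them passes through the rim of `B`
  have hrim : ∀ k, ∃ s ∈ Icc (a k) (b k), γ k s ∈ B \ interior B := fun k ↦ by
    obtain ⟨t, ht, htU⟩ := hout k
    exact exists_mem_diff_interior_of_continuousOn (hab k).le
      (fun t' ht' ↦ ((hγ k).continuousAt ht').continuousWithinAt) hBcl (hγa k).2 ht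
      (fun h ↦ htU (hBU h))
  choose s hs hys using hrim
  -- a convergent subsequence of the rim points, with limit `y ≠ p`
  obtain ⟨y, hyK, φ, hφ, hlim⟩ := hK.tendsto_subseq (x := fun k ↦ γ k (s k)) hys
  have hyp : y ≠ p := fun h ↦ hyK.2 (h ▸ hpB)
  -- the endpoints converge to `p`
  have hpa : Tendsto (fun k ↦ γ (φ k) (a (φ k))) atTop (𝓝 p) :=
    (hu.tendsto fun k ↦ (hγa k).1).comp hφ.tendsto_atTop
  have hpb : Tendsto (fun k ↦ γ (φ k) (b (φ k))) atTop (𝓝 p) :=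
    (hu.tendsto fun k ↦ (hγb k).1).comp hφ.tendsto_atTop
  have hlim' : Tendsto (fun k ↦ γ (φ k) (s (φ k))) atTop (𝓝 y) := hlim
  -- closedness of the causal relation: `y ∈ J⁺(p)` and `p ∈ J⁺(y)`
  have hy1 : y ∈ g.causalFuture τ {p} :=
    mem_causalFuture_singleton_of_tendsto hn hG.2 (x := fun k ↦ γ (φ k) (a (φ k)))
      (y := fun k ↦ γ (φ k) (s (φ k))) hpa hlim'
      (fun k ↦ (hγ (φ k)).apply_mem_causalFuture_apply_left (hs (φ k)))
  have hy2 : p ∈ g.causalFuture τ {y} :=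
    mem_causalFuture_singleton_of_tendsto hn hG.2 (x := fun k ↦ γ (φ k) (s (φ k)))
      (y := fun k ↦ γ (φ k) (b (φ k))) hlim' hpb
      (fun k ↦ (hγ (φ k)).apply_right_mem_causalFuture_apply (hs (φ k)))
  -- two causal curves `p → y → p`; round the corner at `y` to get a closed causal curve
  rcases hy1 with hy1 | ⟨p', hp', γ₁, a₁, b₁, hab₁, hγ₁, hγ₁a, hγ₁b⟩
  · exact hyp (mem_singleton_iff.mp hy1)
  rcases hy2 with hy2 | ⟨y', hy', γ₂, a₂, b₂, hab₂, hγ₂, hγ₂a, hγ₂b⟩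
  · exact hyp (mem_singleton_iff.mp hy2).symm
  rw [mem_singleton_iff] at hp' hy'
  obtain ⟨δ, c, d, hcd, hδ, hδc, hδd⟩ :=
    exists_isFutureCausalCurveOn_trans hn1 hab₁ hab₂ hγ₁ hγ₂ (hγ₁b.trans (hγ₂a.trans hy').symm)
  exact hG.1 δ c d hcd hδ (by rw [hδc, hδd, hγ₁a, hγ₂b, hp'])

end LorentzianMetric

end Literature.Geometry.Lorentzian

end
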